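import HarnessLib
import Summits.QuantumFields.YangMills.Theses.BalabanLadder
import Summits.QuantumFields.YangMills.Theorems.BalabanLadderUVSeamRecStubTransport
import Summits.QuantumFields.YangMills.Theorems.BalabanLadderUVSeamRecUnitTransfer
import Literature.MathematicalPhysics.QuantumLattice.RepLieAlgebraUnitary

/-! ## **v4-F — RESHAPE OF RECORD (owner ym-beyond-p2 g20, 2026-08-26T14:1xZ; director-ym LINE №53 (one reshape per item per generation) /
LINE №57 (no idle or over-reaching binders); trigger = the fleet lead ym-spine-20043-p1 g2's LOCATED REMARK 13:52:23Z).**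
DELTA v3 → v4-F: BOTH stubs are fixed at the FUNDAMENTAL lattice representation `rF := fundamentalLatticeRep 2` of `SU(2)`.
Reason: in v3 the ceilings stub read `UV → ∀ r : LatticeRep SU(2), MomentBounds6 SU(2) r uRec`, but (g2, located in `UVSeamRec_of`)
the `∀ r` is CONSUMED ONLY at the floors witness `r₂`; and it OVER-REACHES `UV`: the measure inside `MomentBounds6 SU(2) r u` is the
Wilson DLR specification `ymSpecification r.ρ β …` — the Wilson action IN THE REPRESENTATION `r` — while Bałaban's theorem ([B12] Thm 2,
the route's `UV`) is the fundamental Wilson action only; for any other faithful `r` (e.g. `N = 4` reducible or spin 3/2) `stub_ceilings`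
would assert ultraviolet ceilings for a DIFFERENT lattice model, which `UV` cannot give.  The femto engine (19353's `CFP` line) and
Track A's N32′ + E0′ both run in the fundamental as well, so fixing `rF` costs nothing in closability and removes the over-reach.
STUBS (sorries = stubs = 2): `stub_ceilings : UV → MomentBounds6 SU(2) rF uRec` (E0′ proper, UV-consuming, XL) ·
`stub_floorsEngine : ∃ a c₀, 0 < c₀ ∧ 0 < a ∧ a/uRec → c₀ ∧ ⟨compact-witness Q2/Q3 floors of SU(2) AT rF in unit a⟩` (v3 body with
`r := rF`; F-B ∧ F-C; NO `UV`; XL = the non-triviality engine at SU(2)-fundamental + two-loop commensurability of its unit).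
COMPOSITION: `UVSeamRec_of` = `stub_ceilings` ⊕ `stub_floorsEngine` through the landed per-representation unit transfer
`UnitTransfer.lowerBounds_uRec_of_engine rF` (p441552) and `stub_transport` (PROVED, p412513) — concludes the item BY NAME.
DISCHARGE PATHS (all landed, instantiate at `r := rF`): `FloorsEngineOfWindow.floorsEngine_of_fcp_commensurable rF a …` (p448741:
CFP-type data FBL ∧ FC2 ∧ FC3 at `rF` in ANY unit window-commensurable with uRec ⇒ the `stub_floorsEngine` data, unit `c₂·uRec`) ·
`FloorsEngineOfWindow.momentBounds6_uRec_of_fbl6_commensurable rF …` (FBL6 at a commensurable unit ⇒ the `stub_ceilings` conclusion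
without `UV`) · engine-agnostic window floors `WindowTransfer` (p443135) / `stubFloorsEngine_of_windowEngineC` (p449464) — so
α ≡ ω in feedability (g2's verdict on the owner's check-lemma, kernel: p448741) and Track A's DISCRETE unit is covered.
HISTORY: v3 26c25409080ac510 (g19, 11:41:44Z: `stub_floors` → `stub_floorsEngine`), v2 8d9f91e80a4c470a, v1 — see
`Cruxes/UVSeamRec/Lines/birth.md` and `floors-unit-transfer.md`; reserve β′ (4a2f08c4c9a514c3) and v4-ω «window floors»
(6c4b28315d8a5cfc) typed, unregistered, not needed. -/

namespace Summit.QuantumFields.YangMills.Cruxes.UVSeamRec.BirthV4F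

open Literature.MathematicalPhysics.QuantumFieldTheory
open Summit.QuantumFields.YangMills.Cruxes.OSLegsFromFemtoAndGap.DlrCollarTransfer
open Filter Topology
open scoped SchwartzMap
open Literature.MathematicalPhysics.QuantumLattice (thetaTest)

/-- The FUNDAMENTAL (defining) lattice representation of `SU(2)` — the representation of Bałaban's Wilson action ([B12] Thm 2) and of the femto engine; v4-F fixes BOTH stubs at it (owner g20, on the lead g2's located remark: the `∀ r` of v3's `stub_ceilings` is consumed only at the floors witness and over-reaches `UV`, whose datum is the fundamental Wilson action). -/
abbrev rF : LatticeRep (Matrix.specialUnitaryGroup (Fin 2) ℂ) :=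
  Literature.MathematicalPhysics.QuantumLattice.fundamentalLatticeRep 2

/-- the unit of record (abbreviation used only inside this skeleton). -/
noncomputable abbrev uRec : ℝ → ℝ := fun β => Real.exp (Summit.QuantumFields.YangMills.Theorems.FemtoTransferGap.sizeLog β 1)

/-- D0 (iso-transport) — PROVED by p4 g16 (`Transport.stub_transport_proved`, axioms trio); kept as a named theorem so `UVSeamRec_of` is unchanged (was: STUB D0, TRUE, M/L-sized: Haar uniqueness along `e : G ≃ₜ* SU(2)`, representation `r₂ ∘ e`, Wilson
measures correspond): floors ∧ ceilings at `SU(2)` in unit `uRec` ⇒ the same for every compact simple `G ≃ₜ* SU(2)`. -/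
theorem stub_transport :
    (letI : MeasurableSpace (Matrix.specialUnitaryGroup (Fin 2) ℂ) := borel _
     haveI : BorelSpace (Matrix.specialUnitaryGroup (Fin 2) ℂ) := ⟨rfl⟩
     ∃ r₂ : LatticeRep (Matrix.specialUnitaryGroup (Fin 2) ℂ),
       LowerBounds (Matrix.specialUnitaryGroup (Fin 2) ℂ) r₂ uRec ∧ MomentBounds6 (Matrix.specialUnitaryGroup (Fin 2) ℂ) r₂ uRec) →
    ∀ (G : Type) [Group G] [TopologicalSpace G] [IsTopologicalGroup G] [CompactSpace G],
      IsCompactSimpleLieGroup G → Nonempty (G ≃ₜ* Matrix.specialUnitaryGroup (Fin 2) ℂ) →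
      letI : MeasurableSpace G := borel G; haveI : BorelSpace G := ⟨rfl⟩;
      ∃ r : LatticeRep G, LowerBounds G r uRec ∧ MomentBounds6 G r uRec := by
  exact Summit.QuantumFields.YangMills.Cruxes.UVSeamRec.Transport.stub_transport_proved

/-- STUB E0′ (HARDEST; the unprinted observable-level theorem, Balaban1989LargeFieldII p. 356): IF Bałaban's apex package holds
at the datum of record (`UV`) THEN the plane-resolved centred-moment ceilings `(C/R⁴)ⁿ` hold for `SU(2)` in the FUNDAMENTAL representation `rF`
(v4-F: the representation of Bałaban's Wilson action; v3's `∀ r` over-reached `UV`), in the unit of record (E0′ in Bałaban's own unit `a_B` + asymptotic scaling `a_B ≤ c·uRec` of the flow of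
record, glued by p4's proved `momentBounds6_of_eventually_le`).  Why it might fail: densities ≠ expectations (last-scale
cluster expansion for YM₄ observables never printed); even at `rF` the identification of Bałaban's block-averaged
expectations with the `ymSpecification rF.ρ` smeared moments is owed (E0′ proper). -/
theorem stub_ceilings :
    Summit.QuantumFields.YangMills.Theses.BalabanLadder.UV →
      letI : MeasurableSpace (Matrix.specialUnitaryGroup (Fin 2) ℂ) := borel _
      haveI : BorelSpace (Matrix.specialUnitaryGroup (Fin 2) ℂ) := ⟨rfl⟩
      MomentBounds6 (Matrix.specialUnitaryGroup (Fin 2) ℂ) rF uRec := by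
  sorry

/-- STUB F-B∧F-C «compact-witness floors at an asymptotically-two-loop engine unit» (XL; NO `UV`; = the engine data of the landed
per-representation transfer `UnitTransfer.lowerBounds_uRec_of_engine rF`, p441552): the FUNDAMENTAL representation `rF` of `SU(2)` and a unit map `a` with `a β / uRec β → c₀ > 0`
carrying the `Q2`/`Q3` floors with COMPACTLY SUPPORTED witnesses.  Supplier: the NT line's conditional femto package at `SU(2)`-fundamental (19353 `stub_cfp : CFP` engine E1–E3; landed
discharge `FloorsEngineOfWindow.floorsEngine_of_fcp_commensurable rF a …`, p448741, from FBL ∧ FC2 ∧ FC3 at `rF` in ANY unit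
window-commensurable with uRec) for
F-B; F-C = two-loop asymptotic scaling of the engine's unit up to a constant (unproved in print; if the engine runs directly at
`a := c₀·uRec`, F-C is `tendsto_const_nhds`).  Why it might fail: as NT (19353) — a β-uniform floor is dimensional transmutation
(barrier PerturbativeInvisibility) — plus the scaling of the non-perturbative unit (Patrascioiu–Seiler vs. consensus). -/
theorem stub_floorsEngine :
    letI : MeasurableSpace (Matrix.specialUnitaryGroup (Fin 2) ℂ) := borel _
    haveI : BorelSpace (Matrix.specialUnitaryGroup (Fin 2) ℂ) := ⟨rfl⟩
    ∃ (a : ℝ → ℝ) (c₀ : ℝ), 0 < c₀ ∧ (∀ β, 0 < a β) ∧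
      Tendsto (fun β => a β / uRec β) atTop (𝓝 c₀) ∧
      (∃ (v : 𝓢(EuclideanSpace ℝ (Fin 4), ℝ)) (ε β₅ Λ₅ : ℝ),
        HasCompactSupport (v : EuclideanSpace ℝ (Fin 4) → ℝ) ∧
        tsupport (v : EuclideanSpace ℝ (Fin 4) → ℝ) ⊆ {y : EuclideanSpace ℝ (Fin 4) | 0 < y 0} ∧ 0 < ε ∧
        ∀ β : ℝ, β₅ ≤ β → ∀ L : ℕ, Λ₅ ≤ a β * L →
          ε ≤ Q2 (Matrix.specialUnitaryGroup (Fin 2) ℂ) rF β L (a β) (thetaTest 4 v) v) ∧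
      (∃ (f g h : 𝓢(EuclideanSpace ℝ (Fin 4), ℝ)) (ε β₅ Λ₅ : ℝ),
        HasCompactSupport (f : EuclideanSpace ℝ (Fin 4) → ℝ) ∧
        HasCompactSupport (g : EuclideanSpace ℝ (Fin 4) → ℝ) ∧
        HasCompactSupport (h : EuclideanSpace ℝ (Fin 4) → ℝ) ∧
        Disjoint (tsupport (f : EuclideanSpace ℝ (Fin 4) → ℝ)) (tsupport (g : EuclideanSpace ℝ (Fin 4) → ℝ)) ∧
        Disjoint (tsupport (g : EuclideanSpace ℝ (Fin 4) → ℝ)) (tsupport (h : EuclideanSpace ℝ (Fin 4) → ℝ)) ∧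
        Disjoint (tsupport (f : EuclideanSpace ℝ (Fin 4) → ℝ)) (tsupport (h : EuclideanSpace ℝ (Fin 4) → ℝ)) ∧
        0 < ε ∧ ∀ β : ℝ, β₅ ≤ β → ∀ L : ℕ, Λ₅ ≤ a β * L →
          ε ≤ |Q3 (Matrix.specialUnitaryGroup (Fin 2) ℂ) rF β L (a β) f g h|) := by
  sorry

/-- COMPOSITION (kernel-checked, closed form): ceilings (UV) ⊕ engine floors ⊕ LANDED unit transfer ⊕ transport ⇒ the item BY NAME. -/
theorem UVSeamRec_of : Summit.QuantumFields.YangMills.Theses.BalabanLadder.UVSeamRec := by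
  intro hUV G _ _ _ _ hG hcl
  letI : MeasurableSpace (Matrix.specialUnitaryGroup (Fin 2) ℂ) := borel _
  haveI : BorelSpace (Matrix.specialUnitaryGroup (Fin 2) ℂ) := ⟨rfl⟩
  have hc := stub_ceilings hUV
  obtain ⟨a, c₀, hc₀, ha, hau, h2, h3⟩ := stub_floorsEngine
  have hlb := Summit.QuantumFields.YangMills.Cruxes.UVSeamRec.UnitTransfer.lowerBounds_uRec_of_engine rF hc₀ ha hau hc h2 h3
  exact stub_transport ⟨rF, hlb, hc⟩ G hG hcl

end Summit.QuantumFields.YangMills.Cruxes.UVSeamRec.BirthV4F
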